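import Summits.CriticalPhenomena.PercolationContinuityZ3.Theorems.SahiMasterFamilyResidualThree
import Summits.CriticalPhenomena.PercolationContinuityZ3.Theorems.SahiMasterFamilyEqPrincipal
import Summits.CriticalPhenomena.PercolationContinuityZ3.Theorems.SahiMasterFamilyCoordPolyPeel
import Summits.CriticalPhenomena.PercolationContinuityZ3.Theorems.SahiMasterFamilyPrivateGluing
import Summits.CriticalPhenomena.PercolationContinuityZ3.Theorems.SahiMasterFamilySharedCoordinate

/-!
# The `r_e = 2` detector `Ψ` of `E_4`: the four-term identity and the CORED case

Support file of the master-family programme (crux `NoHeavyLowerTail`, stmt-CriticalPhenomena-4575; cell `prim-masterthm`, seat P4,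
unit `prim-masterthm-p4-g10`; seat document HOME/prim-masterthm-p4/R42-CORED.md).

At a coordinate `e` on which exactly two members `U_1, U_2` of a quadruple of increasing events depend (`C := U_3`, `D := U_4` are
`e`-free), the `s²`-coefficient of `s ↦ E_4(μ_{p[e↦s]}; U)` is `−Ψ(P_1,P_2;C,D)` with the pivotal sets `P_i` (prim-master-conj's DETECTOR2;
tree `coeff_sahiEP_two_free` / `detector₂_ind_of_forall_sahiE_update_eq_zero`), where for functions `f, g, c, d` and a weight `μ`
  `Ψ(f,g;c,d) = E(g)·E₃(f,c,d) + E(f)·E₃(g,c,d) + E(f)E(g)·(E(cd) − E(c)E(d)) + E(fc)E(gd) + E(fd)E(gc)`.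
This file records:
* `psiDet` and the **four-term identity** `psiDet_eq_four_term` (a formal identity in the moments, any functions, any weight):
  `Ψ(f,g;c,d) = E(f)·E₃(g,c,d) + E(fc)·(E(gd) − E(g)E(d)) + E(fd)·(E(gc) − E(g)E(c)) + 2·E(g)·E(fcd)`;
* the **cored case** (`psiDet_ind_ge`, `sahiE_three_nonpos_of_psiDet_eq_zero`): if `g, c, d` are indicators of INCREASING events `Q, C, D` and `f`
  the indicator of ANY event `P`, then under a product weight `Ψ ≥ E(1_P)·E₃(1_Q,1_C,1_D)` (Harris), so `Ψ = 0` forces `E₃(1_Q,1_C,1_D) ≤ 0`;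
  off the residual class (tree `sahiE_three_ind_nonneg_of_not_residual`) this gives `E₃ = 0`, hence a zero flag
  (`suppZeroFlag_three_of_psiDet_eq_zero_of_not_residual`).
HONEST FRAMING: identities and a one-sided consequence; the rigidity conjecture R₄^{(2)} (prim-master-conj) and the master theorem remain OPEN;
nothing here is positivity of `E_4`.  [this work]
-/

noncomputable section

open scoped Classical

namespace Summit.CriticalPhenomena.PercolationContinuityZ3.Theorems

open Finset Function
open Literature.Combinatorics.Sahi2008
open Literature.Probability.Percolation.DecisionTree (ind ind_of_mem ind_of_not_mem ind_nonneg)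
open Literature.Probability.LatticeModels.Kahn2022 (Affects)
open SharedCoordinate (pivSet)

/-! ### The detector expression and the four-term identity (any weight, any functions) -/

section Algebra

variable {α : Type*} [Fintype α]

/-- **The `r_e = 2` detector expression** `Ψ(f,g;c,d) = E(g)E₃(f,c,d) + E(f)E₃(g,c,d) + E(f)E(g)Cov(c,d) + E(fc)E(gd) + E(fd)E(gc)`
(for indicators of the two pivotal sets and the two `e`-free members this is minus the `s²`-coefficient of `E_4` along `e`,
prim-master-conj DETECTOR2 §1). [this work] -/
def psiDet (μ : α → ℝ) (f g c d : α → ℝ) : ℝ :=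
  ex μ g * sahiE μ 3 ![f, c, d] + ex μ f * sahiE μ 3 ![g, c, d] + ex μ f * ex μ g * (ex μ (c * d) - ex μ c * ex μ d) +
    ex μ (f * c) * ex μ (g * d) + ex μ (f * d) * ex μ (g * c)

/-- `Ψ` is symmetric in its first two arguments. [this work] -/
theorem psiDet_comm (μ : α → ℝ) (f g c d : α → ℝ) : psiDet μ f g c d = psiDet μ g f c d := by
  unfold psiDet; ring

/-- **The four-term identity**: `Ψ(f,g;c,d) = E(f)·E₃(g,c,d) + E(fc)·Cov(g,d) + E(fd)·Cov(g,c) + 2E(g)·E(fcd)`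
(a formal identity in the eleven moments). [this work] -/
theorem psiDet_eq_four_term (μ : α → ℝ) (f g c d : α → ℝ) :
    psiDet μ f g c d = ex μ f * sahiE μ 3 ![g, c, d] + ex μ (f * c) * (ex μ (g * d) - ex μ g * ex μ d) +
      ex μ (f * d) * (ex μ (g * c) - ex μ g * ex μ c) + 2 * ex μ g * ex μ (f * c * d) := by
  unfold psiDet
  rw [sahiE_three, sahiE_three]
  ring

/-- The reduced form when `E(fd) = 0` (e.g. `f = 1_P`, `d = 1_D` with `P ∩ D = ∅`): `Ψ = E(f)E₃(g,c,d) + E(fc)Cov(g,d) + 2E(g)E(fcd)`.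
[this work] -/
theorem psiDet_eq_of_ex_mul_eq_zero (μ : α → ℝ) (f g c d : α → ℝ) (h : ex μ (f * d) = 0) :
    psiDet μ f g c d = ex μ f * sahiE μ 3 ![g, c, d] + ex μ (f * c) * (ex μ (g * d) - ex μ g * ex μ d) +
      2 * ex μ g * ex μ (f * c * d) := by
  rw [psiDet_eq_four_term, h]; ring

end Algebra

/-! ### The cored case: `g, c, d` indicators of increasing events -/

section Cored

variable {ι : Type} [Fintype ι]

omit [Fintype ι] in
/-- Indicator products are indicators of intersections (three sets). [folklore] -/
theorem ind_mul_ind_mul_ind_eq_inter (A B C : Set (Set ι)) : ind A * ind B * ind C = ind (A ∩ B ∩ C) := by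
  rw [ind_mul_ind_eq_inter, ind_mul_ind_eq_inter]

/-- **Cored case, lower bound**: for ANY event `P` and INCREASING events `Q, C, D`, under a product weight
`Ψ(1_P,1_Q;1_C,1_D) ≥ E(1_P)·E₃(1_Q,1_C,1_D)` — the three other terms of the four-term identity are nonnegative by Harris. [this work] -/
theorem psiDet_ind_ge (p : ι → unitInterval) (P : Set (Set ι)) {Q C D : Set (Set ι)} (hQ : IsUpperSet Q) (hC : IsUpperSet C)
    (hD : IsUpperSet D) :
    ex (bernoulliWeight p) (ind P) * sahiE (bernoulliWeight p) 3 ![ind Q, ind C, ind D] ≤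
      psiDet (bernoulliWeight p) (ind P) (ind Q) (ind C) (ind D) := by
  have hμ := isFKGMeasure_bernoulliWeight p
  rw [psiDet_eq_four_term]
  have h1 : 0 ≤ ex (bernoulliWeight p) (ind P * ind C) :=
    ex_nonneg (fun ω => hμ.nonneg ω) fun ω => mul_nonneg (ind_nonneg P ω) (ind_nonneg C ω)
  have h2 : 0 ≤ ex (bernoulliWeight p) (ind P * ind D) :=
    ex_nonneg (fun ω => hμ.nonneg ω) fun ω => mul_nonneg (ind_nonneg P ω) (ind_nonneg D ω)
  have h3 : 0 ≤ ex (bernoulliWeight p) (ind P * ind C * ind D) :=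
    ex_nonneg (fun ω => hμ.nonneg ω) fun ω => mul_nonneg (mul_nonneg (ind_nonneg P ω) (ind_nonneg C ω)) (ind_nonneg D ω)
  have h4 : 0 ≤ ex (bernoulliWeight p) (ind Q) := ex_nonneg (fun ω => hμ.nonneg ω) fun ω => ind_nonneg Q ω
  have hQD : 0 ≤ ex (bernoulliWeight p) (ind Q * ind D) - ex (bernoulliWeight p) (ind Q) * ex (bernoulliWeight p) (ind D) := by
    rw [ind_mul_ind_eq_inter]; linarith [harris_ex_ind p hQ hD]
  have hQC : 0 ≤ ex (bernoulliWeight p) (ind Q * ind C) - ex (bernoulliWeight p) (ind Q) * ex (bernoulliWeight p) (ind C) := by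
    rw [ind_mul_ind_eq_inter]; linarith [harris_ex_ind p hQ hC]
  nlinarith [mul_nonneg h1 hQD, mul_nonneg h2 hQC, mul_nonneg h4 h3]

/-- **Cored case, sign consequence**: if `Ψ(1_P,1_Q;1_C,1_D) = 0` with `Q, C, D` increasing and `E(1_P) > 0`, then `E₃(1_Q,1_C,1_D) ≤ 0`. [this work] -/
theorem sahiE_three_nonpos_of_psiDet_eq_zero (p : ι → unitInterval) {P Q C D : Set (Set ι)} (hQ : IsUpperSet Q) (hC : IsUpperSet C)
    (hD : IsUpperSet D) (hP : 0 < ex (bernoulliWeight p) (ind P)) (h0 : psiDet (bernoulliWeight p) (ind P) (ind Q) (ind C) (ind D) = 0) :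
    sahiE (bernoulliWeight p) 3 ![ind Q, ind C, ind D] ≤ 0 := by
  have h := psiDet_ind_ge p P hQ hC hD
  rw [h0] at h
  by_contra hlt
  exact absurd h (not_le.2 (mul_pos hP (lt_of_not_ge hlt)))

/-- **Cored case off the residual class**: if moreover `(Q, C, D)` has a principal member, a nested pair or an independent pair
(the three strata of `sahiE_three_ind_nonneg_of_not_residual`), then `Ψ = 0` forces `E₃(1_Q,1_C,1_D) = 0`. [this work] -/
theorem sahiE_three_eq_zero_of_psiDet_eq_zero_of_not_residual (p : ι → unitInterval) {P : Set (Set ι)} (U : Fin 3 → Set (Set ι))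
    (hU : ∀ j, IsUpperSet (U j)) (hP : 0 < ex (bernoulliWeight p) (ind P))
    (hstrata : (∃ (i : Fin 3) (S : Set ι), U i = {ω | S ⊆ ω}) ∨ (∃ i j : Fin 3, j ≠ i ∧ U j ⊆ U i) ∨
      (∃ m : Fin 3, SuppZeroFlag 2 (fun j => U (m.succAbove j))))
    (h0 : psiDet (bernoulliWeight p) (ind P) (ind (U 0)) (ind (U 1)) (ind (U 2)) = 0) :
    sahiE (bernoulliWeight p) 3 (fun j => ind (U j)) = 0 := by
  have hle : sahiE (bernoulliWeight p) 3 ![ind (U 0), ind (U 1), ind (U 2)] ≤ 0 :=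
    sahiE_three_nonpos_of_psiDet_eq_zero p (hU 0) (hU 1) (hU 2) hP h0
  have hF : (fun j => ind (U j)) = ![ind (U 0), ind (U 1), ind (U 2)] := by
    funext j; fin_cases j <;> rfl
  have hge := sahiE_three_ind_nonneg_of_not_residual p U hU hstrata
  rw [hF] at hge ⊢
  exact le_antisymm hle hge

end Cored

/-! ### The `k = 4`, `r_e = 2` detector in explicit form: `E_4 ≡ 0` on the fibre forces `Ψ = 0` -/

section Detector

variable {ι : Type} [Fintype ι]

omit [Fintype ι] in
/-- For `e ∉ ω`: `1_{A^{e←1}}(ω) − 1_{A^{e←0}}(ω) = 1_{Piv_e A}(ω)` when `A` is increasing. [this work] -/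
theorem ind_insert_sub_ind_eq_ind_pivSet {e : ι} {A : Set (Set ι)} (hA : IsUpperSet A) {ω : Set ι} (hω : e ∉ ω) :
    ind A (insert e ω) - ind A ω = ind (pivSet e A) ω := by
  have h1 : (insert e ω ∈ A) ↔ ω ∈ secAt e true A := by
    rw [mem_secAt]; simp [forceAt]
  have h0 : (ω ∈ A) ↔ ω ∈ secAt e false A := by
    rw [mem_secAt, forceAt_of_iff]; simp [hω]
  by_cases hin : ω ∈ A
  · have hin' : insert e ω ∈ A := hA (Set.subset_insert e ω) hin
    rw [ind_of_mem hin', ind_of_mem hin, ind_of_not_mem]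
    · ring
    · intro h; exact h.2 (h0.1 hin)
  · by_cases hins : insert e ω ∈ A
    · rw [ind_of_mem hins, ind_of_not_mem hin, ind_of_mem (show ω ∈ pivSet e A from ⟨h1.1 hins, fun h => hin (h0.2 h)⟩)]
      ring
    · rw [ind_of_not_mem hins, ind_of_not_mem hin, ind_of_not_mem]
      · ring
      · intro h; exact hins (h1.2 h.1)

/-- **Section difference of `1_A · h` for `h` ignoring `e`** = the `e`-deleted moment of `1_{Piv_e A} · h`. [this work] -/
theorem secDelta_ind_mul (p : ι → unitInterval) (e : ι) {A : Set (Set ι)} (hA : IsUpperSet A) {h : Set ι → ℝ}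
    (hh : ∀ ω, h (insert e ω) = h ω) : secDelta p e (ind A * h) = secEx p e (ind (pivSet e A) * h) false := by
  unfold secDelta secEx
  rw [← sum_sub_distrib]
  refine sum_congr rfl fun ω hω => ?_
  simp only [mem_filter, mem_univ, true_and] at hω
  simp only [Bool.false_eq_true, if_false, if_true, Pi.mul_apply, hh ω]
  rw [← ind_insert_sub_ind_eq_ind_pivSet hA hω]
  ring

/-- The same with `h = 1`: `XΔ(1_A) = X₀(1_{Piv_e A})`. [this work] -/
theorem secDelta_ind (p : ι → unitInterval) (e : ι) {A : Set (Set ι)} (hA : IsUpperSet A) :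
    secDelta p e (ind A) = secEx p e (ind (pivSet e A)) false := by
  have h := secDelta_ind_mul p e hA (h := fun _ => (1 : ℝ)) (fun _ => rfl)
  have e1 : (ind A * fun _ => (1 : ℝ)) = ind A := by funext ω; simp
  have e2 : (ind (pivSet e A) * fun _ => (1 : ℝ)) = ind (pivSet e A) := by funext ω; simp
  rw [e1, e2] at h
  exact h

/-- The `e`-deleted moment is the expectation under `μ_{p[e↦0]}`. [this work] -/
theorem secEx_false_eq_ex (p : ι → unitInterval) (e : ι) (h : Set ι → ℝ) :
    secEx p e h false = ex (bernoulliWeight (update p e 0)) h := by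
  rw [ex_update_eq p e 0 h, show ((0 : unitInterval) : ℝ) = 0 from rfl]
  ring

omit [Fintype ι] in
/-- Increasing events not affected by `e` ignore `e` at the level of indicators. [folklore] -/
theorem ind_insert_of_not_affects {e : ι} {X : Set (Set ι)} (hX : IsUpperSet X) (he : ¬ Affects X e) (ω : Set ι) :
    ind X (insert e ω) = ind X ω := by
  by_cases hω : ω ∈ X
  · rw [ind_of_mem hω, ind_of_mem (hX (Set.subset_insert e ω) hω)]
  · rw [ind_of_not_mem hω, ind_of_not_mem fun h' => he ⟨ω, hω, h'⟩]

/-- **The `r_e = 2` detector of `E_4`, explicit form.**  Four increasing events `U_0, U_1, U_2, U_3`; `U_2, U_3` not affected by `e`;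
`E_4(μ_{p[e↦s]}; 1_U) = 0` for all `s ∈ (0,1)`.  Then `Ψ(1_{P_0}, 1_{P_1}; 1_{U_2}, 1_{U_3}) = 0` under `μ_{p[e↦0]}`, with the pivotal sets
`P_i = Piv_e U_i` (prim-master-conj DETECTOR2 §1; this is the `k = 4` instance of the tree's `detector₂_ind_of_forall_sahiE_update_eq_zero`,
unfolded). [this work] -/
theorem psiDet_pivSet_eq_zero_of_forall_sahiE_four_eq_zero (p : ι → unitInterval) (e : ι) (U : Fin 4 → Set (Set ι))
    (hU : ∀ j, IsUpperSet (U j)) (he₂ : ¬ Affects (U 2) e) (he₃ : ¬ Affects (U 3) e)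
    (h : ∀ s : unitInterval, (s : ℝ) ∈ Set.Ioo (0 : ℝ) 1 → sahiE (bernoulliWeight (update p e s)) 4 (fun j => ind (U j)) = 0) :
    psiDet (bernoulliWeight (update p e 0)) (ind (pivSet e (U 0))) (ind (pivSet e (U 1))) (ind (U 2)) (ind (U 3)) = 0 := by
  -- the tree's detector with free slots `i₀ = 2` and `i₀.succAbove i₁ = 3` (`i₁ = 2`)
  have e22 : (2 : Fin 4).succAbove (2 : Fin 3) = 3 := by decide
  have he₃' : ¬ Affects (U ((2 : Fin 4).succAbove (2 : Fin 3))) e := by rw [e22]; exact he₃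
  have hdet := detector₂_ind_of_forall_sahiE_update_eq_zero p e U hU 2 2 he₂ he₃' h
  -- evaluate the finite sums/products and the `update`s
  have s40 : (2 : Fin 4).succAbove (0 : Fin 3) = 0 := by decide
  have s41 : (2 : Fin 4).succAbove (1 : Fin 3) = 1 := by decide
  have s30 : (2 : Fin 3).succAbove (0 : Fin 2) = 0 := by decide
  have s31 : (2 : Fin 3).succAbove (1 : Fin 2) = 1 := by decide
  have er0 : (univ : Finset (Fin 2)).erase 0 = {1} := by decide
  have er1 : (univ : Finset (Fin 2)).erase 1 = {0} := by decide
  simp only [freeDetector, Fin.sum_univ_succ, Fin.prod_univ_succ, Fin.sum_univ_zero, Fin.prod_univ_zero, Fin.succ_zero_eq_one,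
    Fin.succ_one_eq_two, s40, s41, s30, s31, e22, er0, er1, prod_singleton, update_apply, add_zero, mul_one] at hdet
  simp only [Fin.isValue, show ((2 : Fin 3) = 0) = False by decide, show ((2 : Fin 3) = 1) = False by decide,
    show ((0 : Fin 3) = 1) = False by decide, show ((1 : Fin 3) = 0) = False by decide, show ((0 : Fin 3) = 2) = False by decide,
    show ((1 : Fin 3) = 2) = False by decide, if_false, if_true] at hdet
  -- `e`-free indicators
  have hi2 : ∀ ω, ind (U 2) (insert e ω) = ind (U 2) ω := ind_insert_of_not_affects (hU 2) he₂
  have hi3 : ∀ ω, ind (U 3) (insert e ω) = ind (U 3) ω := ind_insert_of_not_affects (hU 3) he₃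
  have hi23 : ∀ ω, (ind (U 2) * ind (U 3)) (insert e ω) = (ind (U 2) * ind (U 3)) ω := mul_ignores hi2 hi3
  -- rewrite every section difference as an `e`-deleted moment of a pivotal set
  set P0 := pivSet e (U 0) with hP0
  set P1 := pivSet e (U 1) with hP1
  have d0 : secDelta p e (ind (U 0)) = secEx p e (ind P0) false := secDelta_ind p e (hU 0)
  have d1 : secDelta p e (ind (U 1)) = secEx p e (ind P1) false := secDelta_ind p e (hU 1)
  have d02 : secDelta p e (ind (U 0) * ind (U 2)) = secEx p e (ind P0 * ind (U 2)) false := secDelta_ind_mul p e (hU 0) hi2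
  have d12 : secDelta p e (ind (U 1) * ind (U 2)) = secEx p e (ind P1 * ind (U 2)) false := secDelta_ind_mul p e (hU 1) hi2
  have d03 : secDelta p e (ind (U 0) * ind (U 3)) = secEx p e (ind P0 * ind (U 3)) false := secDelta_ind_mul p e (hU 0) hi3
  have d13 : secDelta p e (ind (U 1) * ind (U 3)) = secEx p e (ind P1 * ind (U 3)) false := secDelta_ind_mul p e (hU 1) hi3
  have d023 : secDelta p e (ind (U 0) * ind (U 2) * ind (U 3)) = secEx p e (ind P0 * ind (U 2) * ind (U 3)) false := by
    rw [mul_assoc, mul_assoc]; exact secDelta_ind_mul p e (hU 0) hi23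
  have d123 : secDelta p e (ind (U 1) * ind (U 2) * ind (U 3)) = secEx p e (ind P1 * ind (U 2) * ind (U 3)) false := by
    rw [mul_assoc, mul_assoc]; exact secDelta_ind_mul p e (hU 1) hi23
  have c32 : ind (U 3) * ind (U 2) = ind (U 2) * ind (U 3) := mul_comm _ _
  have d032 : secDelta p e (ind (U 0) * (ind (U 3) * ind (U 2))) = secEx p e (ind P0 * ind (U 2) * ind (U 3)) false := by
    rw [c32, mul_assoc]; exact secDelta_ind_mul p e (hU 0) hi23
  have d132 : secDelta p e (ind (U 1) * (ind (U 3) * ind (U 2))) = secEx p e (ind P1 * ind (U 2) * ind (U 3)) false := by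
    rw [c32, mul_assoc]; exact secDelta_ind_mul p e (hU 1) hi23
  rw [d0, d1, d02, d12, d03, d13, d023, d123, d032, d132, c32] at hdet
  simp only [secEx_false_eq_ex] at hdet
  unfold psiDet
  rw [sahiE_three, sahiE_three]
  linear_combination hdet

end Detector

/-! ### The cored `r_e = 2` coordinate: `E_4 ≡ 0` forces a `Z_3` sub-triple (off the residual class) -/

section CoredCoordinate

variable {ι : Type} [Fintype ι]

/-- A pivotal set is non-empty when the event depends on the coordinate, so its `e`-deleted mass is positive at interior `p`. [this work] -/
theorem ex_ind_pivSet_pos (p : ι → unitInterval) (hp : ∀ i, (p i : ℝ) ∈ Set.Ioo (0 : ℝ) 1) (e : ι) {A : Set (Set ι)}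
    (he : Affects A e) : 0 < ex (bernoulliWeight (update p e 0)) (ind (pivSet e A)) := by
  obtain ⟨ω, hω, hins⟩ := he
  have heω : e ∉ ω := fun h => hω (by rwa [Set.insert_eq_of_mem h] at hins)
  have hωP : ω ∈ pivSet e A := by
    refine ⟨?_, ?_⟩
    · rw [mem_secAt]; simpa [forceAt] using hins
    · rw [mem_secAt, forceAt_of_iff (iff_of_false heω Bool.false_ne_true)]; exact hω
  have hμ := isFKGMeasure_bernoulliWeight (update p e 0)
  have hterm : ∀ ω' ∈ (univ : Finset (Set ι)), 0 ≤ bernoulliWeight (update p e 0) ω' * ind (pivSet e A) ω' :=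
    fun ω' _ => mul_nonneg (hμ.nonneg ω') (ind_nonneg _ ω')
  have hle := single_le_sum hterm (mem_univ ω)
  have hw : bernoulliWeight (update p e 0) ω = offWeight p e ω := by
    rw [(bernoulliWeight_update p e 0 heω).2, show ((0 : unitInterval) : ℝ) = 0 from rfl]; ring
  rw [ind_of_mem hωP, mul_one, hw] at hle
  exact lt_of_lt_of_le (offWeight_pos hp e ω) hle

/-- **THE CORED `r_e = 2` DETECTOR.**  Four increasing events; the coordinate `e` acts on `U_0`, lies in the CORE of `U_1` (the deletion
`U_1^{e←0}` is empty, i.e. `e` belongs to every configuration of `U_1`), and does not act on `U_2, U_3`.  If `E_4(μ_{p[e↦s]}; 1_U) = 0` for all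
`s ∈ (0,1)` over an interior base point `p`, and the triple `(U_1^{e←1}, U_2, U_3)` is off the residual class (slot `U_3` a cylinder, or a nested
pair, or an independent pair — the strata of `sahiE_three_ind_eq_zero_iff_of_not_residual`), then `(U_1, U_2, U_3)` is a zero flag.
Mechanism: the four-term identity makes `Ψ = E(1_{P_0})·E₃(1_{U_1^{e←1}},1_{U_2},1_{U_3}) + (Harris-nonnegative terms)`, so `Ψ = 0` forces
`E₃ ≤ 0`, the strata give `E₃ ≥ 0`, hence `E₃ = 0`, a zero flag of the contraction, and private gluing (`suppZeroFlag_of_minors_of_private`, the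
deletion having an empty member) lifts it to `(U_1, U_2, U_3)`.  Contrapositive: in a quadruple with NO `Z_3` sub-triple such a coordinate detects
`E_4 ≢ 0` (seat memo R42-CORED.md §2: every one-cored `r=2` coordinate on `≤ 5` coordinates is of this kind). [this work] -/
theorem suppZeroFlag_three_of_cored_coordinate (p : ι → unitInterval) (hp : ∀ i, (p i : ℝ) ∈ Set.Ioo (0 : ℝ) 1) (e : ι)
    (U : Fin 4 → Set (Set ι)) (hU : ∀ j, IsUpperSet (U j)) (he₀ : Affects (U 0) e) (hcore : secAt e false (U 1) = ∅)
    (he₂ : ¬ Affects (U 2) e) (he₃ : ¬ Affects (U 3) e)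
    (h : ∀ s : unitInterval, (s : ℝ) ∈ Set.Ioo (0 : ℝ) 1 → sahiE (bernoulliWeight (update p e s)) 4 (fun j => ind (U j)) = 0)
    (hstrata : (∃ S : Set ι, U 3 = {ω | S ⊆ ω}) ∨
      (∃ (i : Fin 3) (l₀ : Fin 2), (![secAt e true (U 1), U 2, U 3] : Fin 3 → Set (Set ι)) (i.succAbove l₀) ⊆ ![secAt e true (U 1), U 2, U 3] i) ∨
      (∃ m : Fin 3, SuppZeroFlag 2 (fun j => (![secAt e true (U 1), U 2, U 3] : Fin 3 → Set (Set ι)) (m.succAbove j)))) :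
    SuppZeroFlag 3 ![U 1, U 2, U 3] := by
  set V : Fin 3 → Set (Set ι) := ![U 1, U 2, U 3] with hV
  have hVup : ∀ j, IsUpperSet (V j) := by intro j; fin_cases j <;> simp [hV, hU]
  -- the contraction family `U' j = V_j^{e←1}` is `(U_1^{e←1}, U_2, U_3)`
  have hs2 : secAt e true (U 2) = U 2 := secAt_eq_self_of_not_affects (hU 2) he₂ true
  have hs3 : secAt e true (U 3) = U 3 := secAt_eq_self_of_not_affects (hU 3) he₃ true
  set U' : Fin 3 → Set (Set ι) := fun j => secAt e true (V j) with hU'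
  have hU'eq : U' = ![secAt e true (U 1), U 2, U 3] := by
    funext j; fin_cases j
    · rfl
    · exact hs2
    · exact hs3
  have hU'up : ∀ j, IsUpperSet (U' j) := fun j => isUpperSet_secAt e true (hVup j)
  -- Ψ = 0 at `e`, with `P_1 = U_1^{e←1}`
  have hψ := psiDet_pivSet_eq_zero_of_forall_sahiE_four_eq_zero p e U hU he₂ he₃ h
  have hP1 : pivSet e (U 1) = secAt e true (U 1) := by rw [pivSet, hcore, Set.sdiff_empty]
  rw [hP1] at hψ
  -- the strata in the nonnegativity format
  have hstrata' : (∃ (i : Fin 3) (S : Set ι), U' i = {ω | S ⊆ ω}) ∨ (∃ i j : Fin 3, j ≠ i ∧ U' j ⊆ U' i) ∨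
      (∃ m : Fin 3, SuppZeroFlag 2 (fun j => U' (m.succAbove j))) := by
    rw [hU'eq]
    rcases hstrata with ⟨S, hS⟩ | ⟨i, l₀, hsub⟩ | ⟨m, hZ⟩
    · exact Or.inl ⟨2, S, hS⟩
    · exact Or.inr (Or.inl ⟨i, i.succAbove l₀, Fin.succAbove_ne i l₀, hsub⟩)
    · exact Or.inr (Or.inr ⟨m, hZ⟩)
  -- `E₃(U') = 0` under `μ_{p[e↦0]}`
  have hz0 : sahiE (bernoulliWeight (update p e 0)) 3 (fun j => ind (U' j)) = 0 := by
    refine sahiE_three_eq_zero_of_psiDet_eq_zero_of_not_residual (update p e 0) U' hU'up (ex_ind_pivSet_pos p hp e he₀) hstrata' ?_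
    have e0 : U' 0 = secAt e true (U 1) := rfl
    have e1 : U' 1 = U 2 := hs2
    have e2 : U' 2 = U 3 := hs3
    rw [e0, e1, e2]; exact hψ
  -- transport to the interior base point: `E₃` of contractions does not depend on `p_e`
  have hz : sahiE (bernoulliWeight p) 3 (fun j => ind (U' j)) = 0 := by
    have := sahiE_three_secAt_update p e true 0 (p e) V
    rw [update_eq_self] at this
    rw [← this]; exact hz0
  -- zero flag of the contraction, then private gluing (the deletion has the empty member `U_1^{e←0}`)
  have hZ1 : SuppZeroFlag 3 (fun j => secAt e true (V j)) := by
    have h' := (sahiE_three_ind_eq_zero_iff_of_not_residual p hp U' hU'up (by rw [hU'eq]; exact hstrata)).1 hz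
    exact h'
  have hZ0 : SuppZeroFlag 3 (fun j => secAt e false (V j)) :=
    suppZeroFlag_of_mem_empty 2 _ 0 (by simp [hV, hcore])
  have heV : ∀ j : Fin 3, j ≠ 0 → ¬ Affects (V j) e := by
    intro j hj; fin_cases j
    · exact absurd rfl hj
    · exact he₂
    · exact he₃
  exact suppZeroFlag_of_minors_of_private V hVup 0 e heV hZ0 hZ1

end CoredCoordinate

end Summit.CriticalPhenomena.PercolationContinuityZ3.Theorems
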